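import Summits.BirchSwinnertonDyer.BirchSwinnertonDyer.Theorems.EisensteinPrimesBSDpOnCellCImprimitiveCountSplitOfBrHlat
import Literature.NumberTheory.EllipticCurves.IsogenyClassFiniteProofs
import Literature.NumberTheory.EllipticCurves.IsogenyTorsionFreeMemberProofs
import HarnessLib

/-!
# [NORM] IN THE KERNEL, UNCONDITIONALLY: at an odd MULTIPLICATIVE prime every `ℚ`-isogeny class reaches a globally minimal
# curve all of whose rational `p`-lines are RAMIFIED at `p` (Keller–Yin's normalised lattice) — crux 4 `BSDpOnCellC`
# (stmt-BirchSwinnertonDyer-19034), line b1 v12 (cell `bsd-eis`, width seat `bsd-line-x2-p2` gen 11; skeleton of record UNCHANGED, W-79)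

WHY. Seat g10 reduced the SPLIT conjunct of the wall `stub_imprimitiveCount` to conj. 2 VERBATIM plus the single binder
(hlat) «every rational `p`-line of `W` is ramified at `p`» (p679932 `SplitMultWallHlat.imprimitiveCount_split_of_br_of_pub_of_hlat`),
and showed (p679623 `SplitMultNormalisation.bsdp_of_cellC_split_of_normalised`) that the general split X2c pair reduces to such a
curve AT THE `BSDp` LEVEL granted ONE inline sentence [NORM]: «every globally minimal `W/ℚ` with split multiplicative reduction at
an odd `p` (and `E[p]` reducible) is `ℚ`-isogenous to a globally minimal `W'` all of whose rational `p`-lines are ramified at `p`,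
and which has at most one rational `p`-line» — Keller–Yin's standing normalisation (arXiv:2402.12781v2 §0.1 L262–263: "By Ribet's
Lemma we can find a sub-lattice … we can fix a non-split extension `0 → 𝔽(φ) → ρ̄_f → 𝔽(ψ) → 0` where the first character
restricts to `ω` on `G_p` … We can assume this since both the Iwasawa Main Conjectures and the BSD Conjecture is invariant under
isogenies"). THIS FILE PROVES [NORM] IN THE KERNEL, with no named fact, for EVERY odd multiplicative prime (split or not,
`E[p]` reducible or not):

  `exists_isIsogenous_forall_not_lineUnramifiedAt` — `W/ℚ` elliptic, globally minimal, `p ≠ 2`, multiplicative reduction at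
  `p` ⟹ `∃ W'` elliptic, globally minimal, `IsIsogenous W W'`, with (hlat) `∀ Φ, IsRationalLine W' p Φ → ¬ LineUnramifiedAt W' p Φ`
  and (huniq) any two rational `p`-lines of `W'` coincide.

METHOD — THE ISOGENY WALK WITH SHAFAREVICH TERMINATION (Greenberg–Vatsal 2000 §2 p. 28 take ONE step `E' = E/Φ`; Keller–Yin cite
Ribet's lemma; here the walk is run to the end and stopped by the finiteness of the isogeny class, NOT by Mazur–Kenku):
* one step (§2 `walk_base`, §2 `walk_step`): if the current curve `W_k` has a rational line `Φ` UNRAMIFIED at `p`, pass to the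
  globally minimal quotient `W_{k+1} = W_k/Φ` (`X2.IsogenyQuotientLine.exists_isogeny_ker_eq_line`: Silverman AEC III.4.12 + Néron,
  tree theorems); the composite `π_{k+1} : W → W_{k+1}` is CYCLIC of degree `p^{k+1}` and its kernel meets `W[p]` exactly in the
  first line `Φ₀` — because (§1 `isRationalLine_range_not_lineUnramifiedAt`) the image `π_k(W[p]) ⊂ W_k[p]` is a rational line
  RAMIFIED at `p` (the TATE LINE of `W` at a prime above `p`, `X2.IsogenyLineType.exists_tateLine_adicCompletionPrime` on the
  PROVED Tate uniformisation `TateCurve.Silverman1994_thmV53_{,corV54_}tateUniformisation_holds`, meets the unramified `Φ₀`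
  trivially — GV's "the image line has the complementary character `ψ = ωφ⁻¹`", `X2.IsogenyLineType` §1 minus parity), hence
  `≠ Φ`, so `Φ ⊓ π_k(W[p]) = ⊥` (the pattern of `IsogenyTorsionFreeMemberProofs.exists_walk_step`);
* termination (§3): by Shafarevich (Silverman AEC Cor. IX.6.2, the tree THEOREM `WeierstrassCurve.finite_isogenyClass_holds`) the
  curves `ℚ`-isogenous to `W` fall into finitely many `ℚ`-isomorphism classes; two steps `W_i`, `W_j` of the walk in one class
  would give CYCLIC `ℚ`-isogenies `W → V` of degrees `p^i`, `p^j` onto one curve `V`, and two cyclic `ℚ`-isogenies between the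
  same elliptic curves over `ℚ` have the same degree (`degree_eq_of_isCyclic`, from `End_ℚ(E) = ℤ` = the tree's
  `not_hasRationalCM_holds`), so `i = j`: an endless walk would inject `ℕ` into a finite set. Hence some `W_k` has NO unramified
  rational line, i.e. satisfies (hlat); (huniq) is then automatic at a multiplicative prime (p679932
  `SplitMultWallHlat.eq_of_isRationalLine_of_forall_not_lineUnramifiedAt`, imported: a rational line other than the Tate line is fixed by inertia).

RESULT FOR THE LINE. [NORM] is no longer an input: `…BSDpOnCellCSplitNormalisationKernel` (next file) removes `hnorm` from p679623, so
«`BSDp` for every split X2c pair ⟸ `BSDp` for the split X2c pairs at Keller–Yin's normalised lattice» holds modulo Cassels / GZK /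
modularity only (three conjuncts of `stub_publishedFacts`). The v13 cut «conj. 2 ↦ conj. 2 + hlat» recommended by g8–g10 therefore
costs NO new published input.

HONEST FRAMING: helper theorems only (0 defs, 0 named facts introduced, 0 sorry); §1–§3 UNCONDITIONAL (axioms standard); closes no
stub of b1 v12 (conj. 2 is registered without the binder); no summit statement / BSD / MC / IMC is proved for any curve; 0 cells /
labels / tiers move.

References: [KellerYin2024] §0.1 L262–263, §1.3 L886 (arXiv:2402.12781v2); [GreenbergVatsal2000] §2 p. 28, pp. 14–15; [Ribet1976]
Prop. 2.1; [SilvermanAEC2009] III.4.12, III.6.1–6.2, VII.7.2, VIII.8.3, Cor. IX.6.2; [SilvermanATAEC1994] Thm. V.5.3, Cor. V.5.4;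
[Mazur1977] Ch. III §5 (5.4) (pattern of the torsion walk); cell files `X2/IsogenyQuotientLine`, `X2/IsogenyLineType`,
`X2/IsogenyClassStability` (b2b-bsdres), Literature `IsogenyClassFinite{,Proofs}`, `KenkuMinimalLevels` (`degree_eq_of_isCyclic`),
`IsogenyTorsionFreeMemberProofs`.
-/

set_option autoImplicit false
set_option linter.dupNamespace false -- the summit namespace `…BirchSwinnertonDyer.BirchSwinnertonDyer.Theorems` (Sub = Summit, D-0017) trips it

noncomputable section

open scoped Classical

namespace Summit.BirchSwinnertonDyer.BirchSwinnertonDyer.Theorems.IsogenyNormalisation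

open WeierstrassCurve NumberField IsDedekindDomain Field
open Literature.NumberTheory.EllipticCurves Literature.NumberTheory.EllipticCurves.Rank1Residual
  Literature.NumberTheory.GaloisRepresentations
  Summit.BirchSwinnertonDyer.Rank1Residual Summit.BirchSwinnertonDyer.Rank1Residual.X2

variable {W : WeierstrassCurve ℚ} {p : ℕ} [hp : Fact p.Prime]

/-! ## §1 The image of `W[p]` under an isogeny killing exactly an UNRAMIFIED rational line is a rational line RAMIFIED at `p` -/

/-- **The image line is ramified** (Greenberg–Vatsal's "the image of `Φ` has the complementary character"; `X2.IsogenyLineType` §1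
without the parity clause). `W/ℚ` globally minimal with multiplicative reduction at the odd prime `p`; `g : W[p] → W'[p]`
`Γ_ℚ`-equivariant with kernel EXACTLY a rational line `Φ₀` UNRAMIFIED at `p`. Then `g(W[p])` is a rational line of `W'` which is NOT
unramified at `p`: the Tate line `L` of `W` at a prime `𝔓 ∣ p` (`(σ - 1)W[p] ⊆ L` on `I_𝔓`, some `σ₀ ∈ I_𝔓` moving some `x₀ ∈ L`;
`X2.IsogenyLineType.exists_tateLine_adicCompletionPrime` on the proved Tate uniformisation) meets `Φ₀` trivially, and if `σ₀` fixed
`g x₀` then `σ₀ x₀ - x₀ ∈ Φ₀ ⊓ L = ⊥`. [cite: GreenbergVatsal2000, §2 p. 28 (E' = E/Φ) and pp. 14–15]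
[cite: SilvermanATAEC1994, Thm. V.5.3 and Cor. V.5.4] -/
theorem isRationalLine_range_not_lineUnramifiedAt [W.IsElliptic] [W.IsGloballyMinimal] {W' : WeierstrassCurve ℚ}
    (hp2 : p ≠ 2) (hmult : W.HasMultiplicativeReductionAtPrime p)
    (g : geomTorsion W (p : ℤ) →+ geomTorsion W' (p : ℤ))
    (hg : ∀ (σ : absoluteGaloisGroup ℚ) (P : geomTorsion W (p : ℤ)), g (σ • P) = σ • g P)
    {Φ₀ : AddSubgroup (geomTorsion W (p : ℤ))} (hΦ₀ : IsRationalLine W p Φ₀) (hu₀ : LineUnramifiedAt W p Φ₀)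
    (hK : g.ker = Φ₀) :
    IsRationalLine W' p g.range ∧ ¬ LineUnramifiedAt W' p g.range := by
  have hΨ : IsRationalLine W' p g.range :=
    isRationalLine_range g hg (Rank1Residual.natCard_geomTorsion W p) (hK ▸ hΦ₀.1)
  refine ⟨hΨ, fun hunr ↦ ?_⟩
  obtain ⟨v, hv, 𝔓, h𝔓, L, hLcard, hLsub, σ₀, hσ₀, x₀, hx₀, hne⟩ :=
    IsogenyLineType.exists_tateLine_adicCompletionPrime W p
      TateCurve.Silverman1994_thmV53_tateUniformisation_holds
      TateCurve.Silverman1994_thmV53_corV54_tateUniformisation_holds hp2 hmult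
  -- `Φ₀ ⊓ L = ⊥`: `Φ₀` is fixed pointwise by `I_𝔓`, `L` has a moved point
  have hKL : Φ₀ ⊓ L = ⊥ := by
    rcases line_eq_or_inf_eq_bot hΦ₀.1 hLcard with h | h
    · exact absurd (hu₀ v hv 𝔓 h𝔓 σ₀ hσ₀ x₀ (h ▸ hx₀)) hne
    · exact h
  have hy : g x₀ ∈ g.range := AddMonoidHom.mem_range.mpr ⟨x₀, rfl⟩
  have h1 : σ₀ • g x₀ = g x₀ := hunr v hv 𝔓 h𝔓 σ₀ hσ₀ _ hy
  have h2 : σ₀ • x₀ - x₀ ∈ g.ker := by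
    rw [AddMonoidHom.mem_ker, map_sub, hg, h1, sub_self]
  have h3 : σ₀ • x₀ - x₀ ∈ Φ₀ ⊓ L := AddSubgroup.mem_inf.mpr ⟨hK ▸ h2, hLsub σ₀ hσ₀ x₀⟩
  rw [hKL, AddSubgroup.mem_bot, sub_eq_zero] at h3
  exact hne h3

omit hp in
/-- The restriction of a `ℚ`-isogeny `π : W → W'` to `W[p]`, when `ker π ∩ W[p]` is EXACTLY `Φ₀` (as the predicate
`∀ Q ∈ W[p], π Q = O ↔ Q ∈ Φ₀`): an equivariant `g : W[p] →+ W'[p]` with values `π` and `ker g = Φ₀`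
(`X2.IsogenyLineType.exists_restrict_torsion`). [folklore] -/
theorem exists_restrict_torsion_ker_eq {W' : WeierstrassCurve ℚ} (π : Isogeny W W')
    {Φ₀ : AddSubgroup (geomTorsion W (p : ℤ))}
    (hker : ∀ Q : geomTorsion W (p : ℤ), π (Q : W.geomPoints) = 0 ↔ Q ∈ Φ₀) :
    ∃ g : geomTorsion W (p : ℤ) →+ geomTorsion W' (p : ℤ),
      (∀ P : geomTorsion W (p : ℤ), (g P : geomPoints W') = π (P : geomPoints W)) ∧
      (∀ (σ : absoluteGaloisGroup ℚ) (P : geomTorsion W (p : ℤ)), g (σ • P) = σ • g P) ∧ g.ker = Φ₀ := by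
  obtain ⟨g, hgval, hg⟩ := IsogenyLineType.exists_restrict_torsion (p := p) π
  refine ⟨g, hgval, hg, ?_⟩
  ext Q
  rw [AddMonoidHom.mem_ker, ← hker Q, ← hgval Q]
  exact ⟨fun h ↦ by rw [h]; rfl, fun h ↦ Subtype.ext h⟩

/-! ## §2 The walk: base step and inductive step (composites stay CYCLIC of degree `p^k`, kernel `∩ W[p] = Φ₀`) -/

/-- **Walk, base step.** For a rational line `Φ₀ ≤ W[p]` there are a globally minimal elliptic `W₁/ℚ` and a CYCLIC `ℚ`-isogeny
`π : W → W₁` of degree `p = p^1` whose kernel meets `W[p]` exactly in `Φ₀` (indeed `ker π = Φ₀`): the quotient `W₁ = W/Φ₀`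
(`X2.IsogenyQuotientLine.exists_isogeny_ker_eq_line`, Silverman AEC III.4.12 + Néron VIII.8.3), cyclic since a group of prime order
contains no `W[ℓ]`. [cite: SilvermanAEC2009, Prop. III.4.12 with Rem. III.4.13.2] -/
theorem walk_base [W.IsElliptic] {Φ₀ : AddSubgroup (geomTorsion W (p : ℤ))} (hΦ₀ : IsRationalLine W p Φ₀) :
    ∃ (W₁ : WeierstrassCurve ℚ) (_ : W₁.IsElliptic) (_ : W₁.IsGloballyMinimal) (π : Isogeny W W₁),
      π.IsCyclic ∧ π.degree = p ^ 1 ∧ ∀ Q : geomTorsion W (p : ℤ), π (Q : W.geomPoints) = 0 ↔ Q ∈ Φ₀ := by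
  obtain ⟨W₁, hW₁, hmin₁, π, hker, hdeg⟩ := IsogenyQuotientLine.exists_isogeny_ker_eq_line hΦ₀
  haveI := hW₁
  have hScard : Nat.card (Φ₀.map (geomTorsion W (p : ℤ)).subtype) = p := IsogenyQuotientLine.natCard_map_subtype hΦ₀
  refine ⟨W₁, hW₁, hmin₁, π, ?_, by rw [hdeg, pow_one], fun Q ↦ ?_⟩
  · unfold Isogeny.IsCyclic
    rw [hker]
    haveI : Finite (Φ₀.map (geomTorsion W (p : ℤ)).subtype) :=
      Nat.finite_of_card_ne_zero (hScard.symm ▸ hp.out.ne_zero)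
    exact isAddCyclic_of_forall_not_geomTorsion_le W _ (fun ℓ hℓ ↦ not_geomTorsion_le_of_natCard_eq p _ hScard hℓ)
  · change (Q : W.geomPoints) ∈ π.toAddMonoidHom.ker ↔ Q ∈ Φ₀
    rw [hker]
    constructor
    · rintro ⟨R, hR, hRQ⟩
      have : R = Q := Subtype.ext hRQ
      exact this ▸ hR
    · exact fun hQ ↦ ⟨Q, hQ, rfl⟩

/-- **Walk, inductive step.** `W/ℚ` globally minimal, `p ≠ 2` multiplicative; `Φ₀ ≤ W[p]` a rational line UNRAMIFIED at `p`;
`π : W → W_k` a cyclic `ℚ`-isogeny of degree `p^k` onto an elliptic `W_k` whose kernel meets `W[p]` exactly in `Φ₀`; and `Φ ≤ W_k[p]`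
a rational line UNRAMIFIED at `p`. Then composing with the quotient `W_k → W_k/Φ` onto a globally minimal model gives a CYCLIC
`ℚ`-isogeny `π' : W → W_{k+1}` of degree `p^{k+1}` whose kernel again meets `W[p]` exactly in `Φ₀`: the image line `π(W[p])` is
ramified at `p` (§1), so `Φ ⊓ π(W[p]) = ⊥`, so no point of `W[p]` outside `Φ₀` dies in `W_{k+1}`; a kernel of order `p^{k+1}` meeting
`W[p]` in a group of order `p` is cyclic (`isAddCyclic_of_forall_not_geomTorsion_le`). The torsion-walk pattern of
`IsogenyTorsionFreeMemberProofs.exists_walk_step` with Mazur's (5.4) replaced by the Tate line.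
[cite: GreenbergVatsal2000, §2 p. 28 (E' = E/Φ)] [cite: SilvermanAEC2009, Prop. III.4.12 with Rem. III.4.13.2] -/
theorem walk_step [W.IsElliptic] [W.IsGloballyMinimal] (hp2 : p ≠ 2) (hmult : W.HasMultiplicativeReductionAtPrime p)
    {Φ₀ : AddSubgroup (geomTorsion W (p : ℤ))} (hΦ₀ : IsRationalLine W p Φ₀) (hu₀ : LineUnramifiedAt W p Φ₀)
    {Wk : WeierstrassCurve ℚ} [Wk.IsElliptic] (π : Isogeny W Wk) {k : ℕ} (hdeg : π.degree = p ^ k)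
    (hker : ∀ Q : geomTorsion W (p : ℤ), π (Q : W.geomPoints) = 0 ↔ Q ∈ Φ₀)
    {Φ : AddSubgroup (geomTorsion Wk (p : ℤ))} (hΦ : IsRationalLine Wk p Φ) (hu : LineUnramifiedAt Wk p Φ) :
    ∃ (W'' : WeierstrassCurve ℚ) (_ : W''.IsElliptic) (_ : W''.IsGloballyMinimal) (π' : Isogeny W W''),
      π'.IsCyclic ∧ π'.degree = p ^ (k + 1) ∧ ∀ Q : geomTorsion W (p : ℤ), π' (Q : W.geomPoints) = 0 ↔ Q ∈ Φ₀ := by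
  -- the restriction `g = π|W[p]`, kernel `Φ₀`, image `Ψ` ramified at `p`
  obtain ⟨g, hgval, hg, hK⟩ := exists_restrict_torsion_ker_eq (p := p) π hker
  obtain ⟨hΨ, hΨram⟩ := isRationalLine_range_not_lineUnramifiedAt hp2 hmult g hg hΦ₀ hu₀ hK
  -- `Φ ≠ Ψ`, hence `Φ ⊓ Ψ = ⊥`
  have hΦΨ : Φ ⊓ g.range = ⊥ := by
    rcases line_eq_or_inf_eq_bot hΦ.1 hΨ.1 with h | h
    · exact absurd (h ▸ hu) hΨram
    · exact h
  -- the quotient `W'' = Wk/Φ` on a globally minimal model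
  obtain ⟨W'', hW'', hmin'', gq, hgqker, -⟩ := IsogenyQuotientLine.exists_isogeny_ker_eq_line hΦ
  haveI := hW''
  have hScard : Nat.card (Φ.map (geomTorsion Wk (p : ℤ)).subtype) = p := IsogenyQuotientLine.natCard_map_subtype hΦ
  -- degree `p^{k+1}`
  have hdeg' : Nat.card (gq.comp π).toAddMonoidHom.ker = p ^ (k + 1) := by
    have h1 : Nat.card (gq.comp π).toAddMonoidHom.ker = Nat.card gq.toAddMonoidHom.ker * π.degree :=
      AddMonoidHom.natCard_ker_comp_of_surjective gq.toAddMonoidHom π.toAddMonoidHom π.surjective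
    rw [h1, hgqker, hScard, hdeg, pow_succ, mul_comm]
  -- the kernel meets `W[p]` exactly in `Φ₀`
  have hker' : ∀ Q : geomTorsion W (p : ℤ), (gq.comp π) (Q : W.geomPoints) = 0 ↔ Q ∈ Φ₀ := by
    intro Q
    constructor
    · intro hQ
      have hmem : π (Q : W.geomPoints) ∈ gq.toAddMonoidHom.ker := by
        rw [AddMonoidHom.mem_ker, Isogeny.coe_toAddMonoidHom, ← Isogeny.comp_apply]
        exact hQ
      rw [hgqker] at hmem
      obtain ⟨R, hR, hRQ⟩ := hmem
      have hRg : R = g Q := Subtype.ext (by rw [hgval]; exact hRQ)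
      have hgQ : g Q ∈ Φ ⊓ g.range := AddSubgroup.mem_inf.mpr ⟨hRg ▸ hR, AddMonoidHom.mem_range.mpr ⟨Q, rfl⟩⟩
      rw [hΦΨ, AddSubgroup.mem_bot, ← AddMonoidHom.mem_ker, hK] at hgQ
      exact hgQ
    · intro hQ
      rw [Isogeny.comp_apply, (hker Q).mpr hQ, map_zero]
  refine ⟨W'', hW'', hmin'', gq.comp π, ?_, hdeg', hker'⟩
  -- cyclic: a full `W[ℓ]` inside the kernel forces `ℓ = p` and then `W[p] ≤ Φ₀`
  unfold Isogeny.IsCyclic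
  refine isAddCyclic_of_forall_not_geomTorsion_le W _ (fun ℓ hℓ hle ↦ ?_)
  have hdvd : ℓ ^ 2 ∣ p ^ (k + 1) := by
    have h := AddSubgroup.card_dvd_of_le hle
    rwa [natCard_geomTorsion_eq_sq W (Nat.cast_ne_zero.mpr hℓ.ne_zero : (ℓ : ℚ) ≠ 0), hdeg'] at h
  have hℓp : ℓ = p := (Nat.prime_dvd_prime_iff_eq hℓ hp.out).mp
    (hℓ.dvd_of_dvd_pow (dvd_trans (dvd_pow_self ℓ two_ne_zero) hdvd))
  subst hℓp
  have hT : Nat.card (Φ₀.map (geomTorsion W (ℓ : ℤ)).subtype) = ℓ := IsogenyQuotientLine.natCard_map_subtype hΦ₀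
  refine not_geomTorsion_le_of_natCard_eq ℓ (Φ₀.map (geomTorsion W (ℓ : ℤ)).subtype) hT hℓ (fun Q hQ ↦ ?_)
  exact ⟨⟨Q, hQ⟩, (hker' ⟨Q, hQ⟩).mp (hle hQ), rfl⟩

/-! ## §3 Termination by Shafarevich, and the theorem -/

/-- Degrees of cyclic isogenies onto EQUAL targets agree (`degree_eq_of_isCyclic` transported along an equality of Weierstrass
models; `End_ℚ(E) = ℤ`). [cite: SilvermanAEC2009, Thm. III.6.1(a) and Cor. III.6.4(b)] -/
theorem degree_eq_of_isCyclic_of_eq [W.IsElliptic] {V V' : WeierstrassCurve ℚ} [V.IsElliptic] [V'.IsElliptic] (e : V = V')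
    (φ : Isogeny W V) (ψ : Isogeny W V') (hφ : φ.IsCyclic) (hψ : ψ.IsCyclic) : φ.degree = ψ.degree := by
  subst e
  exact degree_eq_of_isCyclic φ ψ hφ hψ

/-- Composing with a change of variables keeps a cyclic isogeny cyclic of the same degree (the change of variables has trivial
kernel, `VariableChange.ker_toIsogeny`). [cite: SilvermanAEC2009, III.3.1(b), III.4 (Def.) and II.2.4.1] -/
theorem isCyclic_degree_comp_toIsogeny {V : WeierstrassCurve ℚ} (π : Isogeny W V) (C : VariableChange ℚ)
    (hcyc : π.IsCyclic) : ((VariableChange.toIsogeny V C).comp π).IsCyclic ∧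
      ((VariableChange.toIsogeny V C).comp π).degree = π.degree := by
  have hk : ((VariableChange.toIsogeny V C).comp π).toAddMonoidHom.ker = π.toAddMonoidHom.ker := by
    rw [Isogeny.ker_comp, VariableChange.ker_toIsogeny, AddMonoidHom.comap_bot]
  refine ⟨?_, ?_⟩
  · unfold Isogeny.IsCyclic at hcyc ⊢
    rw [hk]
    exact hcyc
  · unfold Isogeny.degree
    rw [hk]

/-- **[NORM] — every `ℚ`-isogeny class reaches Keller–Yin's normalised lattice at an odd multiplicative prime, UNCONDITIONALLY.**
For `W/ℚ` elliptic and globally minimal with multiplicative reduction at the odd prime `p` there is an elliptic, globally minimal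
`W'/ℚ`, `ℚ`-isogenous to `W`, such that (hlat) every rational `p`-line of `W'` is ramified at `p` and (huniq) `W'` has at most one
rational `p`-line. Proof: the isogeny walk of §2 (quotient by an unramified rational line while there is one) cannot run for ever —
its `k`-th curve carries a CYCLIC `ℚ`-isogeny from `W` of degree `p^k`; by Shafarevich (`WeierstrassCurve.finite_isogenyClass_holds`,
Silverman AEC Cor. IX.6.2, a tree theorem) the curves met lie in finitely many `ℚ`-isomorphism classes, and two cyclic `ℚ`-isogenies
from `W` to `ℚ`-isomorphic targets have equal degrees (`degree_eq_of_isCyclic`, `End_ℚ(E) = ℤ`), so `k ↦` (class of `W_k`) would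
inject `ℕ` into a finite set; the curve where it stops satisfies (hlat), and (huniq) by p679932's `SplitMultWallHlat.eq_of_isRationalLine_of_forall_not_lineUnramifiedAt`. This is the
sentence "By Ribet's Lemma we can find a sub-lattice … We can assume this since both the Iwasawa Main Conjectures and the BSD
Conjecture is invariant under isogenies" of Keller–Yin, made a theorem of the tree for the curves of class X2 (and every odd `p ‖ N`).
[cite: KellerYin2024, §0.1 (arXiv:2402.12781v2 TeX L262–263) and §1.3 (L886)] [cite: GreenbergVatsal2000, §2 p. 28]
[cite: SilvermanAEC2009, Cor. IX.6.2, Prop. III.4.12, Thm. III.6.1(a)] [cite: SilvermanATAEC1994, Thm. V.5.3 and Cor. V.5.4] -/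
theorem exists_isIsogenous_forall_not_lineUnramifiedAt (W : WeierstrassCurve ℚ) [W.IsElliptic] [W.IsGloballyMinimal]
    (p : ℕ) [hp : Fact p.Prime] (hp2 : p ≠ 2) (hmult : W.HasMultiplicativeReductionAtPrime p) :
    ∃ (W' : WeierstrassCurve ℚ) (_ : W'.IsElliptic) (_ : W'.IsGloballyMinimal), IsIsogenous W W' ∧
      (∀ Φ : AddSubgroup (geomTorsion W' (p : ℤ)), IsRationalLine W' p Φ → ¬ LineUnramifiedAt W' p Φ) ∧
      (∀ Φ Φ' : AddSubgroup (geomTorsion W' (p : ℤ)), IsRationalLine W' p Φ → IsRationalLine W' p Φ' → Φ = Φ') := by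
  -- it suffices to reach (hlat); (huniq) is then automatic at a multiplicative prime
  suffices h : ∃ (W' : WeierstrassCurve ℚ) (_ : W'.IsElliptic) (_ : W'.IsGloballyMinimal), IsIsogenous W W' ∧
      ∀ Φ : AddSubgroup (geomTorsion W' (p : ℤ)), IsRationalLine W' p Φ → ¬ LineUnramifiedAt W' p Φ by
    obtain ⟨W', hE', hmin', hiso, hlat⟩ := h
    have hmult' : W'.HasMultiplicativeReductionAtPrime p :=
      IsogenyQuotientLine.hasMultiplicativeReductionAtPrime_of_isIsogenous hiso hmult
    exact ⟨W', hE', hmin', hiso, hlat, fun Φ Φ' hΦ hΦ' ↦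
      SplitMultWallHlat.eq_of_isRationalLine_of_forall_not_lineUnramifiedAt W' hp2 hmult' hlat hΦ hΦ'⟩
  by_contra hne
  push Not at hne
  -- `W` itself is not normalised: a first unramified rational line `Φ₀`
  obtain ⟨Φ₀, hΦ₀, hu₀⟩ := hne W inferInstance inferInstance (isIsogenous_self W)
  -- Shafarevich: the isogeny class of `W` meets finitely many `ℚ`-isomorphism classes
  obtain ⟨F, hF⟩ := finite_isogenyClass_holds W
  -- the endless walk: for every `k` a cyclic isogeny of degree `p^(k+1)` from `W` onto a member of `F`
  have walk : ∀ k : ℕ, ∃ (Wk : WeierstrassCurve ℚ) (_ : Wk.IsElliptic) (_ : Wk.IsGloballyMinimal) (π : Isogeny W Wk),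
      π.IsCyclic ∧ π.degree = p ^ (k + 1) ∧ ∀ Q : geomTorsion W (p : ℤ), π (Q : W.geomPoints) = 0 ↔ Q ∈ Φ₀ := by
    intro k
    induction k with
    | zero => exact walk_base hΦ₀
    | succ k ih =>
      obtain ⟨Wk, hWk, hmink, π, -, hdeg, hker⟩ := ih
      haveI := hWk
      haveI := hmink
      obtain ⟨Φ, hΦ, hu⟩ := hne Wk hWk hmink ⟨π⟩
      exact walk_step hp2 hmult hΦ₀ hu₀ π hdeg hker hΦ hu
  have landing : ∀ k : ℕ, ∃ (V : WeierstrassCurve ℚ) (_ : V ∈ F) (_ : V.IsElliptic) (ψ : Isogeny W V),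
      ψ.IsCyclic ∧ ψ.degree = p ^ (k + 1) := by
    intro k
    obtain ⟨Wk, hWk, -, π, hcyc, hdeg, -⟩ := walk k
    haveI := hWk
    obtain ⟨C, hC⟩ := hF Wk ⟨π⟩
    obtain ⟨hcyc', hdeg'⟩ := isCyclic_degree_comp_toIsogeny π C hcyc
    exact ⟨C • Wk, hC, inferInstance, (VariableChange.toIsogeny Wk C).comp π, hcyc', hdeg'.trans hdeg⟩
  choose V hVF hVE ψ hcyc hdeg using landing
  -- `k ↦ V k` injects `ℕ` into the finite set `F`
  have hinj : Function.Injective (fun k : ℕ ↦ (⟨V k, hVF k⟩ : F)) := by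
    intro i j hij
    have hV : V i = V j := congrArg Subtype.val hij
    haveI := hVE i
    haveI := hVE j
    have hd : (ψ i).degree = (ψ j).degree := degree_eq_of_isCyclic_of_eq hV (ψ i) (ψ j) (hcyc i) (hcyc j)
    rw [hdeg i, hdeg j] at hd
    exact Nat.succ_injective (Nat.pow_right_injective hp.out.two_le hd)
  haveI : Finite ℕ := Finite.of_injective _ hinj
  exact not_finite ℕ

/-- **[NORM] in the shape of the inline hypothesis `hnorm` of p679623** (`SplitMultNormalisation.bsdp_of_cellC_split_of_normalised`):
for every globally minimal `W/ℚ` with `E[p]` reducible and SPLIT multiplicative reduction at an odd `p`, a `ℚ`-isogenous globally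
minimal `W'` at Keller–Yin's normalised lattice. (The hypotheses `Red` and "split" are idle: `exists_isIsogenous_forall_not_lineUnramifiedAt`
needs only multiplicative reduction.) [cite: KellerYin2024, §0.1 (arXiv:2402.12781v2 TeX L262–263)] -/
theorem hnorm_holds : ∀ (W : WeierstrassCurve ℚ) [W.IsElliptic] [W.IsGloballyMinimal] (p : ℕ) [Fact p.Prime],
    p ≠ 2 → Red W p → W.HasSplitMultiplicativeReductionAtPrime p →
    ∃ (W' : WeierstrassCurve ℚ) (_ : W'.IsElliptic) (_ : W'.IsGloballyMinimal), IsIsogenous W W' ∧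
      (∀ Φ : AddSubgroup (geomTorsion W' (p : ℤ)), IsRationalLine W' p Φ → ¬ LineUnramifiedAt W' p Φ) ∧
      (∀ Φ Φ' : AddSubgroup (geomTorsion W' (p : ℤ)), IsRationalLine W' p Φ → IsRationalLine W' p Φ' → Φ = Φ') :=
  fun W _ _ p _ hp2 _ hsplit ↦
    exists_isIsogenous_forall_not_lineUnramifiedAt W p hp2 hsplit.hasMultiplicativeReductionAtPrime

end Summit.BirchSwinnertonDyer.BirchSwinnertonDyer.Theorems.IsogenyNormalisation

end
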